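import Summits.CriticalPhenomena.SAWScalingLimit.Theses.SAWBrickWallHomotopy
import Summits.CriticalPhenomena.SAWScalingLimit.Theorems.SAWDevelopingMapHexTransferNoBoundaryCreep
import Literature.Probability.LatticeModels.LatticeInterface
import HarnessLib

/-!
# `ModulusUniversality`, line `birth`: honeycomb boundary avoidance from DCS Conjecture 1

Helper file (`--supports stmt-CriticalPhenomena-5790`) of the line `birth` / `registered` for the
crux `SAWBrickWallHomotopy.ModulusUniversality` (skeleton
`Summits/CriticalPhenomena/SAWScalingLimit/Cruxes/ModulusUniversality/Lines/birth.lean`, reshape 6,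
lead c2): the registered PROVABLE stub `stub_boundaryAvoidanceHex_of_hexConjecture`, literal
signature — the route's own crux `HexConjecture` (item stmt-CriticalPhenomena-0808, Duminil-Copin–
Smirnov Conjecture 1, consumed by the route's Assembly anyway) implies the boundary-avoidance
estimate (BA_hex) for the plain critical honeycomb law: for every Dobrushin domain, hexagonal
endpoint approximation and `ρ, ε > 0` there is a collar width `η > 0` such that, eventually in `δ`,
the walks visiting a VERTEX within `η` of `Dᶜ` at distance `≥ ρ` from both marked points have mass
`≤ ε`.

This is a repackaging of the tree theorem `YbRelay.hex_noBoundaryCreep_of_hexSAWScalingLimit`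
(`Theorems/SAWDevelopingMapHexTransferNoBoundaryCreep.lean`, crux HexTransfer, stmt-14221: no
boundary creep under DCS Conjecture 1 — portmanteau for the closed set of curve classes meeting the
closed layer `{infDist(·, ∂D) ≤ η, far}` + Rohde–Schramm Thm 6.1 "SLE₈⸝₃ meets `∂D` only at the marked
points", discharged in the tree): `HexConjecture` is literally `SAW.HexSAWScalingLimit`; a visited
vertex `w` far from the marked points is not the starting vertex (which is near `D.pt 0`,
eventually), so it lies in the discrete domain, hence `δ c_w ∈ D` and
`infDist(δ c_w, ∂D) ≤ infDist(δ c_w, Dᶜ) < η` (`exists_mem_frontier_infDist_compl_eq_dist`); and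
`δ c_w` lies on the trace of the drawn curve (`SimpleGraph.Walk.mem_range_toCurve`).
All bookkeeping tagged [folklore].  No definitions.
-/

noncomputable section

open MeasureTheory Filter Topology Metric Set
open scoped NNReal ENNReal
open Literature.Probability.LatticeModels
open Literature.Probability.RandomPlanarGeometry

namespace Summit.CriticalPhenomena.SAWScalingLimit.Cruxes.ModulusUniversality.Birth

/-- Every vertex of a walk of `Ω_δ` after the first lies in the discrete domain `Ω_δ` (as
`ObservableToSLE.Negative.mem_embMeshDomain_of_mem_support_tail`; three-line proof repeated to keep
the import cone small). [folklore] -/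
theorem mem_embMeshDomain_of_mem_tail {V : Type*} {G : SimpleGraph V} {emb : V → ℂ}
    {Ω : Set ℂ} {δ : ℝ} {u v : V} (p : (SAW.embDomainGraph G emb Ω δ).Walk u v) {w : V}
    (hw : w ∈ p.support.tail) : w ∈ SAW.embMeshDomain G emb Ω δ := by
  rw [← SimpleGraph.Walk.map_snd_darts] at hw
  obtain ⟨d, -, rfl⟩ := List.mem_map.1 hw
  exact ((SAW.embDomainGraph_adj_iff G emb).1 d.adj).2.2

/-- A vertex of a walk of `Ω_δ` other than its starting vertex has its mesh point in `Ω`.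
[folklore] -/
theorem mul_emb_mem_of_mem_support_of_ne {V : Type*} {G : SimpleGraph V} {emb : V → ℂ}
    {Ω : Set ℂ} {δ : ℝ} {u v : V} (p : (SAW.embDomainGraph G emb Ω δ).Walk u v) {w : V}
    (hw : w ∈ p.support) (hne : w ≠ u) : (δ : ℂ) * emb w ∈ Ω := by
  have htail : w ∈ p.support.tail := by
    rw [← SimpleGraph.Walk.cons_tail_support] at hw
    rcases List.mem_cons.1 hw with h | h
    · exact absurd h hne
    · exact h
  exact (SAW.mem_embMeshVertices_iff _).1
    (SAW.embMeshDomain_subset G emb Ω δ (mem_embMeshDomain_of_mem_tail p htail))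

/-- For a point of an open proper subset `Ω` of the plane, the distance to the frontier is at most
the distance to the complement. [folklore] -/
theorem infDist_frontier_le_infDist_compl {Ω : Set ℂ} (hΩ : Ω ≠ univ) {z : ℂ} (hz : z ∈ Ω) :
    infDist z (frontier Ω) ≤ infDist z Ωᶜ := by
  obtain ⟨y, hy, hyd⟩ := exists_mem_frontier_infDist_compl_eq_dist hz hΩ
  rw [hyd]
  exact infDist_le_dist_of_mem hy

/-- **STUB BA_H of line `birth` (reshape 6) — `stub_boundaryAvoidanceHex_of_hexConjecture`
(registered signature, literal): the route crux `HexConjecture` (stmt-0808) implies the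
boundary-avoidance estimate (BA_hex) for the plain critical honeycomb law.**  `HexConjecture` is
`SAW.HexSAWScalingLimit` verbatim; feed it to `YbRelay.hex_noBoundaryCreep_of_hexSAWScalingLimit`
(same `ρ`, `ε`; collar `η`), and observe that the vertex event is contained in the curve event:
eventually `dist(δ c_{a δ}, D.pt 0) < ρ` (`IsEmbEndpointApprox.tendsto_fst`), so a visited vertex `w`
at distance `≥ ρ` from `D.pt 0` is not the starting vertex, lies in `Ω_δ`
(`mem_embMeshDomain_of_mem_tail`), its point `z = δ c_w ∈ D` is on the trace
(`SimpleGraph.Walk.mem_range_toCurve`) and `infDist(z, ∂D) ≤ infDist(z, Dᶜ) < η`. [folklore] -/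
theorem stub_boundaryAvoidanceHex_of_hexConjecture : Summit.CriticalPhenomena.SAWScalingLimit.Theses.SAWBrickWallHomotopy.HexConjecture → ∀ (D : DobrushinDomain) (a b : ℝ → HexVertex), SAW.IsEmbEndpointApprox hexGraph hexCenter D a b → ∀ ρ : ℝ, 0 < ρ → ∀ ε : ℝ, 0 < ε → ∃ η : ℝ, 0 < η ∧ ∀ᶠ δ in nhdsWithin 0 (Set.Ioi 0), SAW.hexSAWLaw D.carrier δ (a δ) (b δ) {γ | ∃ w ∈ γ.walk.support, Metric.infDist ((δ : ℂ) * hexCenter w) D.carrierᶜ < η ∧ ∀ i, ρ ≤ dist ((δ : ℂ) * hexCenter w) (D.pt i)} ≤ ENNReal.ofReal ε := by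
  intro hH D a b hab ρ hρ ε hε
  obtain ⟨η, hη, hev⟩ :=
    Summit.CriticalPhenomena.SAWScalingLimit.Cruxes.HexTransfer.YbRelay.hex_noBoundaryCreep_of_hexSAWScalingLimit
      (fun D a b h => hH D a b h) D a b hab ρ hρ ε hε
  refine ⟨η, hη, ?_⟩
  have hnear : ∀ᶠ δ : ℝ in 𝓝[>] (0 : ℝ), dist ((δ : ℂ) * hexCenter (a δ)) (D.pt 0) < ρ :=
    hab.tendsto_fst (Metric.ball_mem_nhds _ hρ)
  filter_upwards [hev, hnear] with δ h1 h2
  refine le_trans (measure_mono ?_) h1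
  rintro γ ⟨w, hw, hcollar, hfar⟩
  have hne : w ≠ a δ := by
    rintro rfl
    exact absurd (hfar 0) (not_le.2 h2)
  have hzD : (δ : ℂ) * hexCenter w ∈ D.carrier := mul_emb_mem_of_mem_support_of_ne γ.walk hw hne
  refine ⟨(δ : ℂ) * hexCenter w, ?_, ?_, hfar 0, hfar 1⟩
  · show (δ : ℂ) * hexCenter w ∈ (CurveClass.mk ⟨γ.walk.toCurve fun v => (δ : ℂ) * hexCenter v⟩).range
    rw [CurveClass.range_mk]
    exact SimpleGraph.Walk.mem_range_toCurve _ _ hw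
  · exact ((infDist_frontier_le_infDist_compl D.carrier_ne_univ hzD).trans hcollar.le)

end Summit.CriticalPhenomena.SAWScalingLimit.Cruxes.ModulusUniversality.Birth

end
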